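import Literature.MathematicalPhysics.QuantumFieldTheory.Balaban1983to89.B15Prop1ValueOfAnyMinimiser
import Literature.MathematicalPhysics.QuantumFieldTheory.Balaban1983to89.B15Eq177ValueInvarianceB
import Literature.MathematicalPhysics.QuantumFieldTheory.Balaban1983to89.Node00.LargeFieldBackgroundCoPOfRecordB

/-!
# `Balaban1983to89.B15Prop1ValueOfAnyMinimiserB` — [Balaban1989LargeFieldI] (= [B15]) (1.74) p. 192, (1.77) p. 194; [Balaban1988Convergent] (= [III]) (2.12) p. 256;
# [Balaban1984PropagatorsII] (= [II]) (2.3) p. 224: THE FUNCTION (1.77) IS THE VALUE FUNCTION OF THE (2.12) PROBLEM **OVER A BOND-LEVEL DATUM** — `A(U(𝔅, M˙(Q^{s*}V_k))) = A(U′)` for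
# every minimal configuration `U′` of the bond-datum problem — at a generic bond-level solution map `DetBackgroundB`, at node00-def-R's totalised map of record `Node00.bgOfRecordB`, and at
# the bond-level (2.12) data of record `Node00.bgMSCoPOfRecordAtB ∕ bgMSCoPOfRecordB` (THEOREMS ONLY)

statement-level skeleton of published theorems with citation tags; proofs where landed; nothing here is a claim about
the Yang–Mills mass gap

Cell `pub-ymgap` (HUMAN RULINGS D-0062 ∕ D-0149), lane `pub-ymgap-dag-n12-c` g35 (R134 seat (a), N12 = [B15], s1); `--kind proof --supports` K1⁹ `stmt-QuantumFields-27364`;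
count-neutral.  THEOREMS ONLY (0 `def`, 0 `instance`, 0 `sorry`).  (E1) variant (iii-b), class (β) of the lane's census-by-declaration (bus [DAGN12C-G35], 2026-08-30): the bond-datum
edition of dag-n12-w1's `B15Prop1ValueOfAnyMinimiser` — the LOWEST record-keyed Literature head that N12's junction of record v14ᴸ (#10983) actually uses
(`fun177_eq_wilsonAction4_of_isMinimizer ∕ fun177_bgOfRecord_… ∕ fun177std_bgOfRecord_… ∕ fun177std_bgMSCoPOfRecord_eq_wilsonAction4_of_isMinimizer`), re-keyed from reading (b)'s
site-level pair `(bg : DetBackground, Bj M₁ Z k)` to print's [II] (2.3) currency `(bg : DetBackgroundB, bd k (maxDomT M₁ Z))` ∕ `(Node00.bgOfRecordB, 𝔅)`.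

HONESTY GUARD (director-ym №338 (5)).  PURELY ADDITIVE: the (b)-keyed parent stays landed and true on its own text; every theorem below is its parametrisation in the determining
datum (`IsMinimizer ∕ fun177 ∕ fun177std ∕ bg.dom ∕ solvableDom ∕ UminOfRecord ∕ bgOfRecord ∕ bgMSCoPOfRecord(At)` ↦ `IsMinimizerB ∕ fun177B ∕ fun177stdB ∕ bg.dom ∕ solvableDomB ∕
UminOfRecordB ∕ bgOfRecordB ∕ bgMSCoPOfRecord(At)B`) with the parent's proofs verbatim over node00-def-R's S2a ∕ S2b (`isMinimizerB_UminOfRecordB`, `UminOfRecordB_of_not`,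
`mem_solvableDomB_iff`) and the lane's O (`wilsonAction4_eq_of_isMinimizerB`).  No displayed premise of any consumer is deleted or weakened.

WHAT IS HERE.
* §1 generic `bg : DetBackgroundB P G av` (datum in `bg.dom 𝔅`): `fun177B_eq_wilsonAction4_of_isMinimizerB`, `fun177stdB_eq_wilsonAction4_of_isMinimizerB`, `fun177stdB_eq_fun177stdB_of_reg_eq`.
* §2 the totalised map of record `Node00.bgOfRecordB av reg`: `fun177B_bgOfRecordB_eq_wilsonAction4_of_isMinimizerB`, ★ `fun177stdB_bgOfRecordB_eq_wilsonAction4_of_isMinimizerB`,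
  `fun177stdB_bgOfRecordB_of_not_solvable` (junk branch `= 0`), `fun177stdB_bgOfRecordB_eq_of_isMinimizerB_iff`.
* §3 the data of record, every `SU(N)`: ★ `fun177stdB_bgMSCoPOfRecordAtB_eq_wilsonAction4_of_isMinimizerB`, ★★ `fun177stdB_bgMSCoPOfRecordB_eq_wilsonAction4_of_isMinimizerB`,
  `fun177stdB_bgMSCoPOfRecordB_of_not_solvable`.
* §4 the letter bridge: ★★ `valueFamily_of_minimiserFamilyB`, `mem_solvableDomB_of_minimiserFamilyB`.

HONEST SCOPE.  Elementary bookkeeping (two minimisers of one problem have one action); nothing of [15] Thm 1 ∕ Prop. 9 asserted or used; count-neutral; N12 NOT discharged; K0⁷ ∕ K1⁹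
NOT closed; one finite 𝕋⁴ programme at fixed ε — nothing continuum ∕ ℝ⁴ ∕ OS; the Yang–Mills mass gap (Clay) is NOT proved by any of this.

References: [B15] = [Balaban1989LargeFieldI] (1.74) p.192, (1.77) p.194, Prop. 1 p.194; [III] = [Balaban1988Convergent] (2.12)–(2.13) pp.256–257, p.255; [II] = [Balaban1984PropagatorsII]
(2.3) p.224; [15] = [Balaban1985Variational] (2) p.278, (6) p.278, Thm 1 p.279, Prop. 9 (190) p.309.
-/

noncomputable section

namespace Literature.MathematicalPhysics.QuantumFieldTheory.Balaban1983to89.B15Prop1ValueOfAnyMinimiser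

open Literature.MathematicalPhysics.QuantumFieldTheory.Balaban1983to89
open B15DeterminingSets B15DeterminingSetsB B14.Eq213DetSet B14.Eq216Concrete GaugeField B15Sect1Instances B15Eq177ValueInvariance Node00
open Literature.MathematicalPhysics.QuantumFieldTheory.BalabanImbrieJaffe1984to88.BIJ85Eq453GaugeField

variable {P : Params} {G : Type*} [GaugeGroup G]

/-! ## §1  Generic bond-level solution map: (1.77) over `(bg, 𝔅)` is the value of the (2.12) problem -/

section GenericB

variable {av : ∀ j, Averaging P j G} (bg : DetBackgroundB P G av)

/-- **(1.77) OVER A BOND DATUM IS THE VALUE FUNCTION**: for a datum `M˙(Q^{s}V_k)` in the domain of the bond-level solution map `U(𝔅, ·)` and ANY minimal configuration `U′` of the (2.12)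
problem for `(𝔅, M˙(Q^{s}V_k))`, `A(U(𝔅, M˙(Q^{s}V_k))) = A(U′)` — both are minimisers of one problem; twin of `fun177_eq_wilsonAction4_of_isMinimizer`.
[cite: Balaban1989LargeFieldI, (1.77) p.194; Balaban1988Convergent, (2.12) p.256; Balaban1984PropagatorsII, (2.3) p.224] -/
theorem fun177B_eq_wilsonAction4_of_isMinimizerB {k : ℕ} (𝔅 : BDetSet P) (Qs : GaugeField P k G → GaugeField P 0 G)
    {Vk : GaugeField P k G} {U' : GaugeField P 0 G} (hdom : avgFamily av (Qs Vk) ∈ bg.dom 𝔅)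
    (hU' : IsMinimizerB av bg.reg 𝔅 (avgFamily av (Qs Vk)) U') : fun177B bg 𝔅 Qs Vk = wilsonAction4 U' :=
  wilsonAction4_eq_of_isMinimizerB av (bg.isMinimizer 𝔅 _ hdom) hU'

/-- **(1.77) AT PRINT'S PULL-BACK OVER A BOND-DATUM FAMILY IS THE VALUE FUNCTION**: `A(U_{k,Z}(V_k)) = A(U′)` for every minimal configuration `U′` of the (2.12) problem for
`(bd k {Ω_j(Z)}, M˙(Q_k^{s*}V_k))`, the datum lying in the domain; twin of `fun177std_eq_wilsonAction4_of_isMinimizer`. [cite: Balaban1989LargeFieldI, (1.74) p.192, (1.77) p.194; Balaban1988Convergent, (2.12) p.256; Balaban1984PropagatorsII, (2.3) p.224] -/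
theorem fun177stdB_eq_wilsonAction4_of_isMinimizerB (M₁ : ℕ) (bd : ℕ → (ℕ → Set (Site P 0)) → BDetSet P) (Z : Set (Site P 0)) (k : ℕ)
    {Vk : GaugeField P k G} {U' : GaugeField P 0 G} (hdom : avgFamily av (qsstarGIter0 k Vk) ∈ bg.dom (bd k (maxDomT M₁ Z)))
    (hU' : IsMinimizerB av bg.reg (bd k (maxDomT M₁ Z)) (avgFamily av (qsstarGIter0 k Vk)) U') :
    fun177stdB bg M₁ bd Z k Vk = wilsonAction4 U' :=
  fun177B_eq_wilsonAction4_of_isMinimizerB bg (bd k (maxDomT M₁ Z)) (qsstarGIter0 k) hdom hU'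

/-- Two bond-level solution maps over one averaging with one regular class give ONE value of (1.77) at every `V_k` whose datum lies in both domains; twin of
`fun177std_eq_fun177std_of_reg_eq`. [cite: Balaban1989LargeFieldI, (1.77) p.194; Balaban1988Convergent, (2.12) p.256] -/
theorem fun177stdB_eq_fun177stdB_of_reg_eq (bg' : DetBackgroundB P G av) (hreg : bg'.reg = bg.reg) (M₁ : ℕ)
    (bd : ℕ → (ℕ → Set (Site P 0)) → BDetSet P) (Z : Set (Site P 0)) (k : ℕ) {Vk : GaugeField P k G}
    (hdom : avgFamily av (qsstarGIter0 k Vk) ∈ bg.dom (bd k (maxDomT M₁ Z)))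
    (hdom' : avgFamily av (qsstarGIter0 k Vk) ∈ bg'.dom (bd k (maxDomT M₁ Z))) :
    fun177stdB bg M₁ bd Z k Vk = fun177stdB bg' M₁ bd Z k Vk := by
  have h' : IsMinimizerB av bg.reg (bd k (maxDomT M₁ Z)) (avgFamily av (qsstarGIter0 k Vk))
      (bg'.U (bd k (maxDomT M₁ Z)) (avgFamily av (qsstarGIter0 k Vk))) := by
    rw [← hreg]
    exact bg'.isMinimizer _ _ hdom'
  exact fun177stdB_eq_wilsonAction4_of_isMinimizerB bg M₁ bd Z k hdom h'

end GenericB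

/-! ## §2  node00-def-R's totalised bond-level solution map of record `Node00.bgOfRecordB av reg` -/

section OfRecordB

variable [MeasurableSpace G] (av : ∀ j, Averaging P j G) (reg : Set (GaugeField P 0 G))

/-- At the bond-level map of record the domain is the solvable set, so ANY minimiser `U′` of the datum puts the datum in the domain and `fun177B (bgOfRecordB av reg) 𝔅 Q^{s} V_k = A(U′)`;
twin of `fun177_bgOfRecord_eq_wilsonAction4_of_isMinimizer`. [cite: Balaban1989LargeFieldI, (1.77) p.194; Balaban1988Convergent, (2.12) p.256; Balaban1984PropagatorsII, (2.3) p.224] -/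
theorem fun177B_bgOfRecordB_eq_wilsonAction4_of_isMinimizerB {k : ℕ} (𝔅 : BDetSet P) (Qs : GaugeField P k G → GaugeField P 0 G)
    {Vk : GaugeField P k G} {U' : GaugeField P 0 G} (hU' : IsMinimizerB av reg 𝔅 (avgFamily av (Qs Vk)) U') :
    fun177B (bgOfRecordB av reg) 𝔅 Qs Vk = wilsonAction4 U' :=
  fun177B_eq_wilsonAction4_of_isMinimizerB (bgOfRecordB av reg) 𝔅 Qs ((mem_solvableDomB_iff av reg 𝔅 _).2 ⟨U', hU'⟩) hU'

/-- ★ **(1.77) AT THE BOND-LEVEL MAP OF RECORD IS THE ACTION OF ANY MINIMISER**: `fun177stdB (bgOfRecordB av reg) M₁ bd Z k V_k = A(U′)` for every minimal configuration `U′` of the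
(2.12) problem for `(bd k {Ω_j(Z)}, M˙(Q_k^{s*}V_k))` in `reg` — no domain hypothesis; twin of `fun177std_bgOfRecord_eq_wilsonAction4_of_isMinimizer`.
[cite: Balaban1989LargeFieldI, (1.74) p.192, (1.77) p.194; Balaban1988Convergent, (2.12) p.256; Balaban1984PropagatorsII, (2.3) p.224] -/
theorem fun177stdB_bgOfRecordB_eq_wilsonAction4_of_isMinimizerB (M₁ : ℕ) (bd : ℕ → (ℕ → Set (Site P 0)) → BDetSet P) (Z : Set (Site P 0)) (k : ℕ)
    {Vk : GaugeField P k G} {U' : GaugeField P 0 G} (hU' : IsMinimizerB av reg (bd k (maxDomT M₁ Z)) (avgFamily av (qsstarGIter0 k Vk)) U') :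
    fun177stdB (bgOfRecordB av reg) M₁ bd Z k Vk = wilsonAction4 U' :=
  fun177B_bgOfRecordB_eq_wilsonAction4_of_isMinimizerB av reg (bd k (maxDomT M₁ Z)) (qsstarGIter0 k) hU'

/-- **THE JUNK BRANCH** at the bond-level map of record: no minimal configuration of `(bd k {Ω_j(Z)}, M˙(Q_k^{s*}V_k))` in `reg` ⇒ the totalised map returns the unit and (1.77) takes the
value `A(1) = 0` (typing convention of `Node00.UminOfRecordB`); twin of `fun177std_bgOfRecord_of_not_solvable`. [cite: Balaban1989LargeFieldI, (1.77) p.194; Balaban1988Convergent, (2.12) p.256 (typing convention)] -/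
theorem fun177stdB_bgOfRecordB_of_not_solvable (M₁ : ℕ) (bd : ℕ → (ℕ → Set (Site P 0)) → BDetSet P) (Z : Set (Site P 0)) (k : ℕ)
    {Vk : GaugeField P k G} (h : ¬ ∃ U₀, IsMinimizerB av reg (bd k (maxDomT M₁ Z)) (avgFamily av (qsstarGIter0 k Vk)) U₀) :
    fun177stdB (bgOfRecordB av reg) M₁ bd Z k Vk = 0 := by
  rw [fun177stdB_eq, bgKZstdB_apply, bgOfRecordB_U, UminOfRecordB_of_not av reg h]
  unfold wilsonAction4 wilsonAction
  refine Finset.sum_eq_zero fun p _ => ?_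
  have hp : plaqHol (fun _ : PBond P 0 => (1 : G)) p = 1 := by simp [plaqHol]
  rw [hp, GaugeGroup.reTr_one, sub_self, mul_zero]

/-- (1.77) at the bond-level map of record is a function of the (2.12) PREDICATE of the datum (both branches); twin of `fun177std_bgOfRecord_eq_of_isMinimizer_iff`.
[cite: Balaban1989LargeFieldI, (1.77) p.194; Balaban1988Convergent, (2.12) p.256 (bookkeeping)] -/
theorem fun177stdB_bgOfRecordB_eq_of_isMinimizerB_iff (M₁ : ℕ) (bd : ℕ → (ℕ → Set (Site P 0)) → BDetSet P) (Z : Set (Site P 0)) (k : ℕ)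
    {Vk Vk' : GaugeField P k G}
    (h : ∀ U₀, IsMinimizerB av reg (bd k (maxDomT M₁ Z)) (avgFamily av (qsstarGIter0 k Vk)) U₀ ↔
      IsMinimizerB av reg (bd k (maxDomT M₁ Z)) (avgFamily av (qsstarGIter0 k Vk')) U₀) :
    fun177stdB (bgOfRecordB av reg) M₁ bd Z k Vk = fun177stdB (bgOfRecordB av reg) M₁ bd Z k Vk' := by
  by_cases hs : ∃ U₀, IsMinimizerB av reg (bd k (maxDomT M₁ Z)) (avgFamily av (qsstarGIter0 k Vk)) U₀
  · obtain ⟨U₀, hU₀⟩ := hs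
    rw [fun177stdB_bgOfRecordB_eq_wilsonAction4_of_isMinimizerB av reg M₁ bd Z k hU₀,
      fun177stdB_bgOfRecordB_eq_wilsonAction4_of_isMinimizerB av reg M₁ bd Z k ((h U₀).1 hU₀)]
  · have hs' : ¬ ∃ U₀, IsMinimizerB av reg (bd k (maxDomT M₁ Z)) (avgFamily av (qsstarGIter0 k Vk')) U₀ :=
      fun ⟨U₀, hU₀⟩ => hs ⟨U₀, (h U₀).2 hU₀⟩
    rw [fun177stdB_bgOfRecordB_of_not_solvable av reg M₁ bd Z k hs, fun177stdB_bgOfRecordB_of_not_solvable av reg M₁ bd Z k hs']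

end OfRecordB

/-! ## §3  The bond-level (2.12) data of record on a support (`Node00.bgMSCoPOfRecordAtB` ∕ `Node00.bgMSCoPOfRecordB`), every `SU(N)` -/

section RecordB

variable {F : T4Continuum.T4Family} {N : ℕ} [NeZero N]

/-- ★ **(1.77) AT THE BOND-LEVEL DATUM ON A SUPPORT IS THE ACTION OF ANY MINIMISER**: for the class `regMSCoPOfRecordAt F N ν K k Ω₀ Ω` and any minimal configuration `U′` of the
(2.12) problem for `(bd k′ {Ω_j(Z)}, M˙(Q_{k′}^{s*}V))` in that class, `fun177stdB (bgMSCoPOfRecordAtB F N ν K k Ω₀ Ω) M₁ bd Z k′ V = A(U′)`; twin of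
`fun177std_bgMSCoPOfRecordAt_eq_wilsonAction4_of_isMinimizer`. [cite: Balaban1989LargeFieldI, (1.74) p.192, (1.77) p.194; Balaban1988Convergent, (2.12) p.256, p.255; Balaban1985Variational, (2) p.278; Balaban1984PropagatorsII, (2.3) p.224] -/
theorem fun177stdB_bgMSCoPOfRecordAtB_eq_wilsonAction4_of_isMinimizerB (ν : Stage7Numerics) (K k : ℕ) (Ω₀ : Set (Site (F.P K) 0))
    (Ω : ℕ → Set (Site (F.P K) 0)) (M₁ : ℕ) (bd : ℕ → (ℕ → Set (Site (F.P K) 0)) → BDetSet (F.P K)) (Z : Set (Site (F.P K) 0)) (k' : ℕ)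
    {V : GaugeField (F.P K) k' (SU N)} {U' : GaugeField (F.P K) 0 (SU N)}
    (hU' : IsMinimizerB (avOfRecord F N K) (regMSCoPOfRecordAt F N ν K k Ω₀ Ω) (bd k' (maxDomT M₁ Z))
      (avgFamily (avOfRecord F N K) (qsstarGIter0 k' V)) U') :
    fun177stdB (bgMSCoPOfRecordAtB F N ν K k Ω₀ Ω) M₁ bd Z k' V = wilsonAction4 U' :=
  fun177stdB_bgOfRecordB_eq_wilsonAction4_of_isMinimizerB (avOfRecord F N K) (regMSCoPOfRecordAt F N ν K k Ω₀ Ω) M₁ bd Z k' hU'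

/-- ★★ **(1.77) AT THE BOND-LEVEL DATUM OF RECORD IS THE ACTION OF ANY MINIMISER** — the form the re-keyed N12 endpoints read (`bg := bgMSCoPOfRecordB F N ν K k Ω`, the class
`regMSCoPOfRecord F N ν K k Ω` on the support of record, print's class unchanged): `fun177stdB (bgMSCoPOfRecordB F N ν K k Ω) M₁ bd Z k′ V = A(U′)` for every minimal configuration `U′`
of the (2.12) problem for `(bd k′ {Ω_j(Z)}, M˙(Q_{k′}^{s*}V))` in that class; twin of `fun177std_bgMSCoPOfRecord_eq_wilsonAction4_of_isMinimizer`.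
[cite: Balaban1989LargeFieldI, (1.74) p.192, (1.77) p.194, Prop. 1 p.194; Balaban1988Convergent, (2.12) p.256, p.255; Balaban1985Variational, (2) p.278, Prop. 9 (190) p.309; Balaban1984PropagatorsII, (2.3) p.224] -/
theorem fun177stdB_bgMSCoPOfRecordB_eq_wilsonAction4_of_isMinimizerB (ν : Stage7Numerics) (K k : ℕ) (Ω : ℕ → Set (Site (F.P K) 0))
    (M₁ : ℕ) (bd : ℕ → (ℕ → Set (Site (F.P K) 0)) → BDetSet (F.P K)) (Z : Set (Site (F.P K) 0)) (k' : ℕ)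
    {V : GaugeField (F.P K) k' (SU N)} {U' : GaugeField (F.P K) 0 (SU N)}
    (hU' : IsMinimizerB (avOfRecord F N K) (regMSCoPOfRecord F N ν K k Ω) (bd k' (maxDomT M₁ Z))
      (avgFamily (avOfRecord F N K) (qsstarGIter0 k' V)) U') :
    fun177stdB (bgMSCoPOfRecordB F N ν K k Ω) M₁ bd Z k' V = wilsonAction4 U' :=
  fun177stdB_bgOfRecordB_eq_wilsonAction4_of_isMinimizerB (avOfRecord F N K) (regMSCoPOfRecord F N ν K k Ω) M₁ bd Z k' hU'

/-- The junk branch at the bond-level datum of record: no minimal configuration in the class of record ⇒ (1.77) vanishes there; twin of `fun177std_bgMSCoPOfRecord_of_not_solvable`.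
[cite: Balaban1989LargeFieldI, (1.77) p.194; Balaban1988Convergent, (2.12) p.256 (typing convention)] -/
theorem fun177stdB_bgMSCoPOfRecordB_of_not_solvable (ν : Stage7Numerics) (K k : ℕ) (Ω : ℕ → Set (Site (F.P K) 0))
    (M₁ : ℕ) (bd : ℕ → (ℕ → Set (Site (F.P K) 0)) → BDetSet (F.P K)) (Z : Set (Site (F.P K) 0)) (k' : ℕ) {V : GaugeField (F.P K) k' (SU N)}
    (h : ¬ ∃ U₀, IsMinimizerB (avOfRecord F N K) (regMSCoPOfRecord F N ν K k Ω) (bd k' (maxDomT M₁ Z))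
      (avgFamily (avOfRecord F N K) (qsstarGIter0 k' V)) U₀) :
    fun177stdB (bgMSCoPOfRecordB F N ν K k Ω) M₁ bd Z k' V = 0 :=
  fun177stdB_bgOfRecordB_of_not_solvable (avOfRecord F N K) (regMSCoPOfRecord F N ν K k Ω) M₁ bd Z k' h

end RecordB

/-! ## §4  The letter bridge over a bond datum: a family of minimisers is a family of configurations carrying the value (1.77) -/

section BridgeB

variable [MeasurableSpace G] (av : ∀ j, Averaging P j G) (reg : Set (GaugeField P 0 G))

/-- ★★ **FROM A MINIMISER FAMILY TO A VALUE FAMILY, bond datum**: a family `Ũ : X → (bonds → 𝕄)` which at every `x ∈ S` reads SOME minimal configuration `U′` of the (2.12) problem for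
the datum of `cfg x` on the bonds `bd k {Ω_j(Z)}` reads at every `x ∈ S` a configuration with `A(U′) = A(U_{k,Z}(cfg x))` at the bond-level map of record; twin of
`valueFamily_of_minimiserFamily`. [cite: Balaban1989LargeFieldI, (1.77) p.194, Prop. 1 p.194; Balaban1985Variational, Prop. 9 (190) p.309; Balaban1988Convergent, (2.12) p.256; Balaban1984PropagatorsII, (2.3) p.224] -/
theorem valueFamily_of_minimiserFamilyB {X 𝕄 : Type*} (S : Set X) (ρ : G → 𝕄) (M₁ : ℕ) (bd : ℕ → (ℕ → Set (Site P 0)) → BDetSet P)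
    (Z : Set (Site P 0)) (k : ℕ) (cfg : X → GaugeField P k G) (Ũ : X → PBond P 0 → 𝕄)
    (h : ∀ x ∈ S, ∃ U' : GaugeField P 0 G, (∀ b, Ũ x b = ρ (U' b)) ∧
      IsMinimizerB av reg (bd k (maxDomT M₁ Z)) (avgFamily av (qsstarGIter0 k (cfg x))) U') :
    ∀ x ∈ S, ∃ U' : GaugeField P 0 G, (∀ b, Ũ x b = ρ (U' b)) ∧
      fun177stdB (bgOfRecordB av reg) M₁ bd Z k (cfg x) = wilsonAction4 U' := fun x hx => by
  obtain ⟨U', hŨ, hU'⟩ := h x hx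
  exact ⟨U', hŨ, fun177stdB_bgOfRecordB_eq_wilsonAction4_of_isMinimizerB av reg M₁ bd Z k hU'⟩

/-- The same bridge with the solvability consequence displayed: a minimiser family over `S` puts every datum `M˙(Q_k^{s*}(cfg x))`, `x ∈ S`, in the solvable set of the bond-level map of
record, i.e. [15] Thm 1's existence clause holds along the family; twin of `mem_solvableDom_of_minimiserFamily`. [cite: Balaban1985Variational, Thm 1 p.279; Balaban1988Convergent, (2.12) p.256; Balaban1984PropagatorsII, (2.3) p.224] -/
theorem mem_solvableDomB_of_minimiserFamilyB {X 𝕄 : Type*} (S : Set X) (ρ : G → 𝕄) (M₁ : ℕ) (bd : ℕ → (ℕ → Set (Site P 0)) → BDetSet P)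
    (Z : Set (Site P 0)) (k : ℕ) (cfg : X → GaugeField P k G) (Ũ : X → PBond P 0 → 𝕄)
    (h : ∀ x ∈ S, ∃ U' : GaugeField P 0 G, (∀ b, Ũ x b = ρ (U' b)) ∧
      IsMinimizerB av reg (bd k (maxDomT M₁ Z)) (avgFamily av (qsstarGIter0 k (cfg x))) U') :
    ∀ x ∈ S, avgFamily av (qsstarGIter0 k (cfg x)) ∈ (bgOfRecordB av reg).dom (bd k (maxDomT M₁ Z)) := fun x hx => by
  obtain ⟨U', -, hU'⟩ := h x hx
  rw [bgOfRecordB_dom]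
  exact (mem_solvableDomB_iff av reg _ _).2 ⟨U', hU'⟩

end BridgeB

end Literature.MathematicalPhysics.QuantumFieldTheory.Balaban1983to89.B15Prop1ValueOfAnyMinimiser

end
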